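import Summits.BirchSwinnertonDyer.BirchSwinnertonDyer.Theorems.ResidualThetaTransportAtTwoThetaLayerLambdaCongruenceAtTwoCuspSpanFunctional
import HarnessLib

/-!
# Route `ResidualThetaTransportAtTwo`, cruxes Kan⁺ (stmt-BirchSwinnertonDyer-20688) / 21437: the node at EVERY prime level where
# `⟨4⟩` has index `≤ 2` in `(ℤ/p)ˣ` — UNIFORMLY (no certificate, no `decide`)

Cell `bsd-wall`, lead prover `bsd-wall-rtt-p3` g9 (2026-08-28). THEOREMS ONLY; `--supports stmt-BirchSwinnertonDyer-20688`; BSD is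
not proved by this.

THEOREM (`cuspSpanEvenAtTwo_of_index_four_le_two`). Let `p` be an odd prime and suppose some `r₀` satisfies: every non-zero
residue is `4^k` or `r₀·4^k` (i.e. `[(ℤ/p)ˣ : ⟨4⟩] ≤ 2`; equivalently `2` or `−2` is a primitive root mod `p`, or `p ≡ 3 (mod 4)`
and `2` generates the squares). Then `CuspSpanEvenAtTwo p`. PROOF: by `cuspSpanEvenAtTwo_of_functional_criterion` it suffices that
every `F : 𝔽ₚ → 𝔽₂` with `F 1 = 0` and `F(4u) = F(u)` (the 4-INVARIANCE of `…CuspSpanFourInvariance`, Dirichlet) is multiplicative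
on `𝔽ₚˣ` — and under the index hypothesis `F` is `0` on `⟨4⟩` and constant `= F(r₀)` on `r₀⟨4⟩`, which is a homomorphism of
`(ℤ/p)ˣ/⟨4⟩` (order `≤ 2`) either way. Neither the `S`-companion nor the three-term rule is used. This contains Theorem A at prime
level (`±⟨4⟩ = (ℤ/p)ˣ`: 7, 11, 19, 23, 47, 59, …) AND the whole `p ≡ 5 (mod 8)`, `⟨2⟩ = (ℤ/p)ˣ` family of the `B₁`-certificates
(13, 29, 37, 53, 61, 101, 149, 173, 181, 197, 269, …) as ONE statement; under Artin's primitive-root conjecture (Hooley, GRH) it is a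
set of primes of density `≥ A = 0.3739…`.

References: [Rademacher1929] §1; [Pollack2003] Conj. 6.3; C. Hooley, J. reine angew. Math. 225 (1967) 209–220 (Artin's conjecture
under GRH) — context only, nothing conditional is used.
-/

set_option autoImplicit false
set_option linter.dupNamespace false

open scoped MatrixGroups

open CongruenceSubgroup

namespace Summit.BirchSwinnertonDyer.BirchSwinnertonDyer.Theorems.SignedMuAtTwo

variable {p : ℕ} [Fact p.Prime]

/-- **The node at every odd prime level with `[(ℤ/p)ˣ : ⟨4⟩] ≤ 2`** (coset representative `r₀`; `r₀ ∈ ⟨4⟩` allowed).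
[cite: Pollack2003, Conj. 6.3] [cite: Rademacher1929, §1] -/
theorem cuspSpanEvenAtTwo_of_index_four_le_two (hp2 : p ≠ 2) (r₀ : ZMod p)
    (h : ∀ u : ZMod p, u ≠ 0 → ∃ k : ℕ, u = 4 ^ k ∨ u = r₀ * 4 ^ k) : CuspSpanEvenAtTwo p := by
  refine cuspSpanEvenAtTwo_of_functional_criterion hp2 fun F h1 h4 _ _ _ _ ↦ ?_
  have hp : p.Prime := Fact.out
  have h40 : (4 : ZMod p) ≠ 0 := by
    intro h0
    have h0' : ((4 : ℕ) : ZMod p) = 0 := by exact_mod_cast h0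
    have hd : p ∣ 2 ^ 2 := by norm_num; exact (ZMod.natCast_eq_zero_iff 4 p).mp h0'
    exact hp2 ((Nat.prime_dvd_prime_iff_eq hp Nat.prime_two).mp (hp.dvd_of_dvd_pow hd))
  -- `F` is invariant under `u ↦ 4^k u`
  have hinv : ∀ (k : ℕ) (u : ZMod p), u ≠ 0 → F (4 ^ k * u) = F u := by
    intro k
    induction k with
    | zero => intro u _; rw [pow_zero, one_mul]
    | succ k ih =>
      intro u hu
      rw [pow_succ, mul_comm ((4 : ZMod p) ^ k) 4, mul_assoc, h4 _ (mul_ne_zero (pow_ne_zero _ h40) hu), ih u hu]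
  have hF4 : ∀ k : ℕ, F (4 ^ k) = 0 := fun k ↦ by rw [← mul_one ((4 : ZMod p) ^ k), hinv k 1 one_ne_zero, h1]
  have hF4r : ∀ k : ℕ, r₀ ≠ 0 → F (r₀ * 4 ^ k) = F r₀ := fun k hr0 ↦ by rw [mul_comm, hinv k r₀ hr0]
  have two : F r₀ + F r₀ = 0 := CharTwo.add_self_eq_zero _
  intro x y hx hy
  rcases h x hx with ⟨a, ha | ha⟩ <;> rcases h y hy with ⟨b, hb | hb⟩
  · rw [ha, hb, ← pow_add, hF4, hF4, hF4, add_zero]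
  · have hr0 : r₀ ≠ 0 := by rintro rfl; rw [zero_mul] at hb; exact hy hb
    rw [ha, hb, hinv a (r₀ * 4 ^ b) (by rw [← hb]; exact hy), hF4, hF4r b hr0, zero_add]
  · have hr0 : r₀ ≠ 0 := by rintro rfl; rw [zero_mul] at ha; exact hx ha
    rw [ha, hb, mul_comm, hinv b (r₀ * 4 ^ a) (by rw [← ha]; exact hx), hF4, hF4r a hr0, add_zero]
  · have hr0 : r₀ ≠ 0 := by rintro rfl; rw [zero_mul] at ha; exact hx ha
    rcases h (r₀ * r₀) (mul_ne_zero hr0 hr0) with ⟨m, hm | hm⟩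
    · have e : r₀ * 4 ^ a * (r₀ * 4 ^ b) = 4 ^ (m + a + b) := by rw [pow_add, pow_add, ← hm]; ring
      rw [ha, hb, e, hF4, hF4r a hr0, hF4r b hr0, two]
    · have hr4 : r₀ = 4 ^ m := mul_left_cancel₀ hr0 hm
      have e1 : r₀ * 4 ^ a = 4 ^ (m + a) := by rw [hr4, pow_add]
      have e2 : r₀ * 4 ^ b = 4 ^ (m + b) := by rw [hr4, pow_add]
      rw [ha, hb, e1, e2, ← pow_add, hF4, hF4, hF4, add_zero]

end Summit.BirchSwinnertonDyer.BirchSwinnertonDyer.Theorems.SignedMuAtTwo
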